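import Summits.MatrixMultiplication.MatrixMultiplication.Theses.OctonionicLaser

/-!
# MatrixMultiplication / OctonionicLaser — the assembly `Assembly` (stmt-MatrixMultiplication-7940)

Route `route-MatrixMultiplication-OctonionicLaser`, item stmt-MatrixMultiplication-7940 (`Assembly`,
rank 1):

  `OctAsymptoticRank → OctSpectralDominance → MatrixMultiplication`.

Proof (pure glue over PROVED Literature facts; it is also, verbatim, the type of the route's
kernel-checked deciding theorem
`Summit.MatrixMultiplication.MatrixMultiplication.Theses.OctonionicLaser.closes`, and the proof below
is self-contained). By Strassen duality (`strassen_duality_asymptoticRank_holds ℂ`, second clause)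
pick a universal spectral point `F` with `F(⟨2,2,2⟩) = R̃(⟨2,2,2⟩)`, and `R̃(⟨2,2,2⟩) = 2^ω`
(`asymptoticRank_matMulTensor ℂ 2`). Spectral dominance (ii) and the first clause of duality give
`2·2^ω = 2·F(⟨2,2,2⟩) ≤ F(t₈) ≤ R̃(t₈) ≤ 8` by (i); hence `2^ω ≤ 4 = 2^2`, so `ω ≤ 2`, and
`omega_two_le ℂ` gives `ω(ℂ) = 2`, which is `MatrixMultiplication` (`MatrixMultiplication_iff`).

References: V. Strassen, *The asymptotic spectrum of tensors*, J. reine angew. Math. 384 (1988),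
Thm. 3.8; M. Christandl, P. Vrana, J. Zuiddam, *Universal points in the asymptotic spectrum of
tensors*, J. AMS 36 (2023), Prop. 1.6; M. Bläser, *Fast Matrix Multiplication*, Theory of Computing
Graduate Surveys 5 (2013), §7.
-/

-- Summit-side namespace `Summit.<Summit>.<Sub>.Theorems`; for this single-conjunct summit the two
-- coincide (`MatrixMultiplication.MatrixMultiplication`), so the file silences `dupNamespace`.
set_option linter.dupNamespace false

namespace Summit.MatrixMultiplication.MatrixMultiplication.Theorems

open Summit.MatrixMultiplication.MatrixMultiplication.Theses.OctonionicLaser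
open Literature.Computability.AlgebraicComplexity

/-- The glue inequality of route OctonionicLaser: `OctAsymptoticRank` (`R̃(t₈) ≤ 8`) and
`OctSpectralDominance` (`2·F(⟨2,2,2⟩) ≤ F(t₈)` for every universal spectral point `F` over `ℂ`)
give `2·2^{ω(ℂ)} ≤ 8`: evaluate dominance at a universal spectral point attaining `R̃(⟨2,2,2⟩) =
2^ω` (Strassen duality, `asymptoticRank_matMulTensor`) and bound `F(t₈) ≤ R̃(t₈) ≤ 8`.
[cite: Strassen1988, Thm. 3.8] [cite: ChristandlVranaZuiddam2023, Prop. 1.6] -/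
theorem octonionicLaser_two_mul_rpow_omega_le (h₁ : OctAsymptoticRank) (h₂ : OctSpectralDominance) :
    2 * (2 : ℝ) ^ omega ℂ ≤ 8 := by
  -- a universal spectral point attaining `R̃(⟨2,2,2⟩)` (Strassen duality, second clause)
  obtain ⟨F, hF, hFeq⟩ := (strassen_duality_asymptoticRank_holds ℂ (matMulTensor ℂ 2 2 2)).2
  -- `F ≤ R̃` on every tensor (Strassen duality, first clause)
  have hFle : ∀ {ι κ μ : Type} [Fintype ι] [Fintype κ] [Fintype μ] (t : ι → κ → μ → ℂ),
      F t ≤ asymptoticRank t := fun t => (strassen_duality_asymptoticRank_holds ℂ t).1 F hF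
  -- `2 · F(⟨2,2,2⟩) ≤ F(t₈) ≤ R̃(t₈) ≤ 8`
  have h8 : 2 * F (matMulTensor ℂ 2 2 2) ≤ 8 := (h₂ F hF).trans ((hFle _).trans h₁)
  -- `F(⟨2,2,2⟩) = R̃(⟨2,2,2⟩) = 2^ω`
  have h222 : asymptoticRank (matMulTensor ℂ 2 2 2) = (2 : ℝ) ^ omega ℂ := by
    have h := asymptoticRank_matMulTensor ℂ 2 (by norm_num)
    exact_mod_cast h
  rwa [hFeq, h222] at h8

/-- From the glue inequality: `OctAsymptoticRank` and `OctSpectralDominance` give `ω(ℂ) ≤ 2`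
(`2·2^ω ≤ 8 ⇒ 2^ω ≤ 2^2 ⇒ ω ≤ 2`, monotonicity of `2^·`). [folklore] -/
theorem octonionicLaser_omega_le_two (h₁ : OctAsymptoticRank) (h₂ : OctSpectralDominance) :
    omega ℂ ≤ 2 := by
  have h8 := octonionicLaser_two_mul_rpow_omega_le h₁ h₂
  -- `2^ω ≤ 4 = 2^2`, hence `ω ≤ 2`
  have h4 : (2 : ℝ) ^ omega ℂ ≤ (2 : ℝ) ^ (2 : ℝ) := by
    have h22 : (2 : ℝ) ^ (2 : ℝ) = 4 := by norm_num
    rw [h22]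
    linarith
  exact (Real.rpow_le_rpow_left_iff (by norm_num : (1 : ℝ) < 2)).1 h4

/-- **Assembly of route OctonionicLaser** (item stmt-MatrixMultiplication-7940):
`OctAsymptoticRank → OctSpectralDominance → MatrixMultiplication`. With a universal spectral point
`F` attaining `R̃(⟨2,2,2⟩) = 2^ω` (Strassen duality), dominance and (i) give
`2·2^ω ≤ F(t₈) ≤ R̃(t₈) ≤ 8`, so `ω(ℂ) ≤ 2`; `ω(ℂ) ≥ 2` is `omega_two_le`, and
`MatrixMultiplication_iff` (`MatrixMultiplication ↔ ω(ℂ) = 2`) closes. The statement is literally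
the type of the route's deciding theorem `Theses.OctonionicLaser.closes`; the proof here is
self-contained. [cite: Strassen1988, Thm. 3.8] [cite: ChristandlVranaZuiddam2023, Prop. 1.6]
[cite: Blaser2013, §7] -/
theorem octonionicLaser_assembly_proof :
    Summit.MatrixMultiplication.MatrixMultiplication.Theses.OctonionicLaser.Assembly := by
  unfold Summit.MatrixMultiplication.MatrixMultiplication.Theses.OctonionicLaser.Assembly
  intro h₁ h₂
  rw [_root_.MatrixMultiplication_iff]
  exact le_antisymm (octonionicLaser_omega_le_two h₁ h₂) (omega_two_le ℂ)

end Summit.MatrixMultiplication.MatrixMultiplication.Theorems
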